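import Summits.Ventures.LatticeQCDFlow.Scoring.SU2TorusRectangleMerging
import Summits.Ventures.LatticeQCDFlow.Scoring.SU2TorusRectangleSites
import Summits.Ventures.LatticeQCDFlow.Scoring.SU2TorusPlaquetteCharacterIntegral
import HarnessLib

/-!
# SU(2) on the 2-torus: the Haar integral of a product of plaquette characters WITH A RECTANGULAR WILSON LOOP INSERTED

HONEST FRAMING: exact (Metropolis-corrected) sampling algorithms for lattice gauge theory;
figures of merit are autocorrelation/cost numbers at stated couplings and volumes; no
continuum-physics claim.

Venture `LatticeQCDFlow` (cell pub-lqcd), sub-topic `Scoring`; FANOUT row 5 (`s0-sun-a`), GEN-11.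
NEW WORK of the cell (placement rule); towards the EXACT finite-volume SU(2) Wilson loops `W_{R×T}` on
`(ℤ/L)²` (the lead's NOT-TYPED item 'larger Wilson loops', oracle X02's `wilson_loops`).  Notation as in
`SU2TorusRectangleMerging`: corner `(i,j)`, `1 ≤ R ≤ L`, `1 ≤ T ≤ L`, the rectangle
`A = {(i+a, j+b) : a < R, b < T}` (as a `Finset`, the image of `range R ×ˢ range T`), its boundary holonomy
`W = W_{R×T}`, `χ_n = U_n(a₀)`, and `I(m') = [m' constant]·((m'_0+1)^{L²})⁻¹` the full-torus character
integral of `SU2TorusCharacterIntegral`.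

* **`integral_su2a0_loop_mul_prod_su2Character`** — THE INSERTED CHARACTER INTEGRAL: for every
  `m : Λ → ℕ`, with `μ = m(i,j)`,
  `∫ a₀(W)·∏_x χ_{m_x}(U_x) dHaar^{⊗E}
     = [m ≡ μ on A]·( ½·((μ+2)/(μ+1))^{RT−1}·[m ≡ μ+1 off A]·((μ+2)^{L²})⁻¹
                     + ½·[μ ≠ 0]·(μ/(μ+1))^{RT−1}·[m ≡ μ−1 off A]·(μ^{L²})⁻¹ )`.
  PROOF — no gluing of the complement: merge the rectangle (`integral_mul_prod_rect_su2Character`,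
  spectator `a₀(W)·∏_{x∉A}χ`), insert `a₀·χ_μ = ½(χ_{μ+1} + χ_{μ−1})` (Clebsch–Gordan,
  `mul_chebyshevU_eval`), and UN-merge: the same lemma applied to the assignment `ν` on `A`, `m` off `A`
  identifies `∫ χ_ν(W)·∏_{x∉A}χ_{m_x}(U_x) = (ν+1)^{RT−1}·I(m[A ↦ ν])`, which the full-torus integral
  evaluates.  So only the assignments 'μ inside, μ ± 1 outside' survive, with weight
  `½ (d_out/d_in)^{RT−1} d_out^{−L²}` — the disc-times-handlebody gluing formula, obtained by merging alone.

Elementary given the two parents; nothing is cited; no `def`.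
-/

noncomputable section

open Real MeasureTheory Set Function Finset Polynomial.Chebyshev
open Literature.MathematicalPhysics.QuantumFieldTheory Literature.MathematicalPhysics.QuantumLattice
open Summit.Ventures.LatticeQCDFlow.Exactness
open Summit.Ventures.LatticeQCDFlow.Theory2.Lattice

namespace Summit.Ventures.LatticeQCDFlow.Scoring

variable {L : ℕ} [NeZero L]

/-! ## §1. Un-merging: a loop character against the plaquettes off the rectangle -/

/-- **Un-merging the rectangle.**  For `m : Λ → ℕ` and a representation `ν` on the loop:
`∫ (∏_{x∉A} χ_{m_x}(U_x))·χ_ν(W) dHaar^{⊗E} = (ν+1)^{RT−1}·[∀ x ∉ A, m_x = ν]·((ν+1)^{L²})⁻¹` — the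
merging lemma applied to the assignment `ν` on `A`, `m` off `A`, read backwards, and the full-torus
integral `SU2TorusCharacterIntegral.integral_prod_su2Character_plaquettes`. -/
theorem integral_prod_compl_rect_mul_su2Character_loop (i j : ZMod L) {R T : ℕ} (hR : 1 ≤ R) (hRL : R ≤ L)
    (hT : 1 ≤ T) (hTL : T ≤ L) (m : Site 2 L → ℕ) (ν : ℕ) :
    ∫ V, (∏ x ∈ ((range R ×ˢ range T).image (fun p : ℕ × ℕ => (![i + p.1, j + p.2] : Site 2 L)))ᶜ,
          (U ℝ (m x)).eval (su2a0 (plaquetteHolonomy V x 0 1))) *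
        (U ℝ ν).eval (su2a0
          (((List.range R).map fun a : ℕ => V (![i + a, j], 0)).prod *
            ((List.range T).map fun b : ℕ => V (![i + R, j + b], 1)).prod *
            (((List.range R).map fun a : ℕ => V (![i + a, j + T], 0)).prod)⁻¹ *
            (((List.range T).map fun b : ℕ => V (![i, j + b], 1)).prod)⁻¹))
        ∂(Measure.pi fun _ : Edge 2 L => haarProbability (Matrix.specialUnitaryGroup (Fin 2) ℂ)) =
      ((ν : ℝ) + 1) ^ (R * T - 1) *
        (if (∀ x, x ∉ (range R ×ˢ range T).image (fun p : ℕ × ℕ => (![i + p.1, j + p.2] : Site 2 L)) →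
            m x = ν) then ((((ν : ℝ) + 1) ^ (L ^ 2)))⁻¹ else 0) := by
  set A := (range R ×ˢ range T).image (fun p : ℕ × ℕ => (![i + p.1, j + p.2] : Site 2 L)) with hA
  set mν : Site 2 L → ℕ := fun x => if x ∈ A then ν else m x with hmν
  have hcorner : (![i, j] : Site 2 L) ∈ A := by
    have := mem_rect i j (R := R) (T := T) (a := 0) (b := 0) (by omega) (by omega)
    rwa [Nat.cast_zero, add_zero, add_zero] at this
  have hin : ∀ a < R, ∀ b < T, mν ![i + a, j + b] = ν := fun a ha b hb => by
    simp only [hmν]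
    exact if_pos (mem_rect i j ha hb)
  have hij : mν ![i, j] = ν := by
    simp only [hmν]
    exact if_pos hcorner
  have hout : ∀ x ∉ A, mν x = m x := fun x hx => by
    simp only [hmν]
    exact if_neg hx
  -- the spectator: the plaquettes off the rectangle
  set Fout : GaugeConfig 2 L (Matrix.specialUnitaryGroup (Fin 2) ℂ) → ℝ := fun V =>
    ∏ x ∈ Aᶜ, (U ℝ (m x)).eval (su2a0 (plaquetteHolonomy V x 0 1)) with hFout
  have hFoutc : Continuous Fout := by
    refine continuous_finsetProd _ fun x _ => continuous_su2Character_comp (m x) ?_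
    unfold plaquetteHolonomy
    fun_prop
  have hFv : ∀ a b : ℕ, 0 < a → a < R → b < T → ∀ V g, Fout (update V (![i + a, j + b], 1) g) = Fout V := by
    intro a b ha0 haR hb V g
    simp only [hFout]
    refine Finset.prod_congr rfl fun x hx => ?_
    rw [plaquetteHolonomy_update_rect_vert i j (Finset.mem_compl.mp hx) ha0 haR hb]
  have hFh : ∀ b : ℕ, 0 < b → b < T → ∀ V g, Fout (update V (![i, j + b], 0) g) = Fout V := by
    intro b hb0 hbT V g
    simp only [hFout]
    refine Finset.prod_congr rfl fun x hx => ?_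
    rw [plaquetteHolonomy_update_rect_horiz i j (Finset.mem_compl.mp hx) hR hb0 hbT]
  -- the merging lemma for `mν`, read backwards
  have hM := integral_mul_prod_rect_su2Character i j mν hR hRL T hT hTL Fout hFoutc hFv hFh
  rw [if_pos (fun a ha b hb => (hin a ha b hb).trans hij.symm), hij] at hM
  -- its left-hand side is the full-torus integral of `mν`
  have hfull : ∀ V : GaugeConfig 2 L (Matrix.specialUnitaryGroup (Fin 2) ℂ),
      Fout V * ∏ b ∈ range T, ∏ a ∈ range R,
        (U ℝ (mν ![i + a, j + b])).eval (su2a0 (plaquetteHolonomy V ![i + a, j + b] 0 1)) =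
      ∏ x : Site 2 L, (U ℝ (mν x)).eval (su2a0 (plaquetteHolonomy V x 0 1)) := by
    intro V
    rw [← Finset.prod_mul_prod_compl A, prod_rect_eq i j hRL hTL, mul_comm]
    congr 1
    exact Finset.prod_congr rfl fun x hx => by rw [hout x (Finset.mem_compl.mp hx)]
  simp_rw [hfull] at hM
  rw [integral_prod_su2Character_plaquettes mν] at hM
  -- constancy of `mν` is `m ≡ ν` off the rectangle
  have hconst : (∀ x, mν x = mν 0) ↔ ∀ x, x ∉ A → m x = ν := by
    constructor
    · intro h x hx
      rw [← hout x hx, h x, ← h ![i, j], hij]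
    · intro h x
      have hall : ∀ y, mν y = ν := fun y => by
        by_cases hy : y ∈ A
        · simp only [hmν, if_pos hy]
        · rw [hout y hy, h y hy]
      rw [hall, hall]
  have hpow : (((ν : ℝ) + 1) ^ (R * T - 1)) ≠ 0 := by positivity
  have key : ∫ V, Fout V * (U ℝ ν).eval (su2a0
      (((List.range R).map fun a : ℕ => V (![i + a, j], 0)).prod *
        ((List.range T).map fun b : ℕ => V (![i + R, j + b], 1)).prod *
        (((List.range R).map fun a : ℕ => V (![i + a, j + T], 0)).prod)⁻¹ *
        (((List.range T).map fun b : ℕ => V (![i, j + b], 1)).prod)⁻¹))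
      ∂(Measure.pi fun _ : Edge 2 L => haarProbability (Matrix.specialUnitaryGroup (Fin 2) ℂ)) =
      ((ν : ℝ) + 1) ^ (R * T - 1) *
        (if (∀ x, mν x = mν 0) then ((((mν 0 : ℝ) + 1) ^ (L ^ 2)))⁻¹ else 0) := by
    rw [hM, ← mul_assoc, mul_inv_cancel₀ hpow, one_mul]
  rw [key]
  by_cases hC : ∀ x, x ∉ A → m x = ν
  · have h0 : mν 0 = ν := by
      rw [← (hconst.mpr hC) ![i, j], hij]  -- mν 0 = mν ![i,j] ... orientation fixed below
    rw [if_pos (hconst.mpr hC), if_pos hC, h0]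
  · rw [if_neg (fun h => hC (hconst.mp h)), if_neg hC]

/-! ## §2. The inserted character integral -/

/-- **THE CHARACTER INTEGRAL WITH A WILSON LOOP INSERTED.**  For `L ≥ 1`, a corner `(i,j)`, sizes
`1 ≤ R ≤ L`, `1 ≤ T ≤ L`, every `m : Λ → ℕ` and product Haar measure on the links of `(ℤ/L)²`, with
`A = {(i+a,j+b)}` the rectangle, `W` its boundary holonomy and `μ = m(i,j)`:
`∫ a₀(W)·∏_x χ_{m_x}(U_x) dHaar^{⊗E}
   = [m ≡ μ on A]·( ½·((μ+2)/(μ+1))^{RT−1}·[m ≡ μ+1 off A]·((μ+2)^{L²})⁻¹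
                   + ½·[μ ≠ 0]·(μ/(μ+1))^{RT−1}·[m ≡ μ−1 off A]·(μ^{L²})⁻¹ )` —
only the assignments 'μ inside, μ ± 1 outside' survive (merge the rectangle, Clebsch–Gordan
`a₀χ_μ = ½(χ_{μ+1} + χ_{μ−1})`, un-merge). -/
theorem integral_su2a0_loop_mul_prod_su2Character (i j : ZMod L) {R T : ℕ} (hR : 1 ≤ R) (hRL : R ≤ L)
    (hT : 1 ≤ T) (hTL : T ≤ L) (m : Site 2 L → ℕ) :
    ∫ V, su2a0
          (((List.range R).map fun a : ℕ => V (![i + a, j], 0)).prod *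
            ((List.range T).map fun b : ℕ => V (![i + R, j + b], 1)).prod *
            (((List.range R).map fun a : ℕ => V (![i + a, j + T], 0)).prod)⁻¹ *
            (((List.range T).map fun b : ℕ => V (![i, j + b], 1)).prod)⁻¹) *
        ∏ x : Site 2 L, (U ℝ (m x)).eval (su2a0 (plaquetteHolonomy V x 0 1))
        ∂(Measure.pi fun _ : Edge 2 L => haarProbability (Matrix.specialUnitaryGroup (Fin 2) ℂ)) =
      if (∀ a < R, ∀ b < T, m ![i + a, j + b] = m ![i, j]) then
        (1 / 2) * (((m ![i, j] : ℝ) + 2) / ((m ![i, j] : ℝ) + 1)) ^ (R * T - 1) *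
            (if (∀ x, x ∉ (range R ×ˢ range T).image (fun p : ℕ × ℕ => (![i + p.1, j + p.2] : Site 2 L)) →
              m x = m ![i, j] + 1) then ((((m ![i, j] : ℝ) + 2) ^ (L ^ 2)))⁻¹ else 0) +
          (1 / 2) * (if m ![i, j] = 0 then 0 else
            ((m ![i, j] : ℝ) / ((m ![i, j] : ℝ) + 1)) ^ (R * T - 1) *
              (if (∀ x, x ∉ (range R ×ˢ range T).image (fun p : ℕ × ℕ => (![i + p.1, j + p.2] : Site 2 L)) →
                m x = m ![i, j] - 1) then ((((m ![i, j] : ℝ)) ^ (L ^ 2)))⁻¹ else 0))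
      else 0 := by
  set A := (range R ×ˢ range T).image (fun p : ℕ × ℕ => (![i + p.1, j + p.2] : Site 2 L)) with hA
  set W : GaugeConfig 2 L (Matrix.specialUnitaryGroup (Fin 2) ℂ) → Matrix.specialUnitaryGroup (Fin 2) ℂ :=
    fun V => ((List.range R).map fun a : ℕ => V (![i + a, j], 0)).prod *
      ((List.range T).map fun b : ℕ => V (![i + R, j + b], 1)).prod *
      (((List.range R).map fun a : ℕ => V (![i + a, j + T], 0)).prod)⁻¹ *
      (((List.range T).map fun b : ℕ => V (![i, j + b], 1)).prod)⁻¹ with hW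
  set Fout : GaugeConfig 2 L (Matrix.specialUnitaryGroup (Fin 2) ℂ) → ℝ := fun V =>
    ∏ x ∈ Aᶜ, (U ℝ (m x)).eval (su2a0 (plaquetteHolonomy V x 0 1)) with hFout
  have hWc : Continuous W := by
    refine ((Continuous.mul (Continuous.mul ?_ ?_) (Continuous.inv ?_)).mul (Continuous.inv ?_)) <;>
      exact continuous_list_prod _ fun k _ => continuous_apply _
  have hFoutc : Continuous Fout := by
    refine continuous_finsetProd _ fun x _ => continuous_su2Character_comp (m x) ?_
    unfold plaquetteHolonomy
    fun_prop
  have hWdef : ∀ V : GaugeConfig 2 L (Matrix.specialUnitaryGroup (Fin 2) ℂ),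
      ((List.range R).map fun a : ℕ => V (![i + a, j], 0)).prod *
        ((List.range T).map fun b : ℕ => V (![i + R, j + b], 1)).prod *
        (((List.range R).map fun a : ℕ => V (![i + a, j + T], 0)).prod)⁻¹ *
        (((List.range T).map fun b : ℕ => V (![i, j + b], 1)).prod)⁻¹ = W V := fun V => rfl
  simp_rw [hWdef]
  -- Step 1: merge the rectangle, with `a₀(W)·∏_{x∉A} χ` as spectator
  have hsplit : ∀ V : GaugeConfig 2 L (Matrix.specialUnitaryGroup (Fin 2) ℂ),
      su2a0 (W V) * ∏ x : Site 2 L, (U ℝ (m x)).eval (su2a0 (plaquetteHolonomy V x 0 1)) =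
      (su2a0 (W V) * Fout V) * ∏ b ∈ range T, ∏ a ∈ range R,
        (U ℝ (m ![i + a, j + b])).eval (su2a0 (plaquetteHolonomy V ![i + a, j + b] 0 1)) := by
    intro V
    rw [← Finset.prod_mul_prod_compl A, prod_rect_eq i j hRL hTL]
    simp only [hFout]
    ring
  simp_rw [hsplit]
  have hWv : ∀ a b : ℕ, 0 < a → a < R → b < T → ∀ V g, W (update V (![i + a, j + b], 1) g) = W V := by
    intro a b ha0 haR hb V g
    simp only [hW]
    exact loop_update_rect_vert i j hRL b ha0 haR V g
  have hWh : ∀ b : ℕ, 0 < b → b < T → ∀ V g, W (update V (![i, j + b], 0) g) = W V := by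
    intro b hb0 hbT V g
    simp only [hW]
    exact loop_update_rect_horiz i j hTL hb0 hbT V g
  have hFv : ∀ a b : ℕ, 0 < a → a < R → b < T → ∀ V g, Fout (update V (![i + a, j + b], 1) g) = Fout V := by
    intro a b ha0 haR hb V g
    simp only [hFout]
    refine Finset.prod_congr rfl fun x hx => ?_
    rw [plaquetteHolonomy_update_rect_vert i j (Finset.mem_compl.mp hx) ha0 haR hb]
  have hFh : ∀ b : ℕ, 0 < b → b < T → ∀ V g, Fout (update V (![i, j + b], 0) g) = Fout V := by
    intro b hb0 hbT V g
    simp only [hFout]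
    refine Finset.prod_congr rfl fun x hx => ?_
    rw [plaquetteHolonomy_update_rect_horiz i j (Finset.mem_compl.mp hx) hR hb0 hbT]
  rw [integral_mul_prod_rect_su2Character i j m hR hRL T hT hTL (fun V => su2a0 (W V) * Fout V)
    ((continuous_su2a0.comp hWc).mul hFoutc)
    (fun a b ha0 haR hb V g => by simp only [hWv a b ha0 haR hb, hFv a b ha0 haR hb])
    (fun b hb0 hbT V g => by simp only [hWh b hb0 hbT, hFh b hb0 hbT])]
  simp_rw [hWdef]
  by_cases hC : ∀ a < R, ∀ b < T, m ![i + a, j + b] = m ![i, j]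
  swap
  · rw [if_neg hC, if_neg hC]
  rw [if_pos hC, if_pos hC]
  -- Step 2: Clebsch–Gordan `a₀·χ_μ = ½(χ_{μ+1} + χ_{μ−1})`
  set μ := m ![i, j] with hμ
  have hun : ∀ ν : ℕ, ∫ V, Fout V * (U ℝ ν).eval (su2a0 (W V))
      ∂(Measure.pi fun _ : Edge 2 L => haarProbability (Matrix.specialUnitaryGroup (Fin 2) ℂ)) =
      ((ν : ℝ) + 1) ^ (R * T - 1) * (if (∀ x, x ∉ A → m x = ν) then ((((ν : ℝ) + 1) ^ (L ^ 2)))⁻¹ else 0) :=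
    fun ν => integral_prod_compl_rect_mul_su2Character_loop i j hR hRL hT hTL m ν
  have hint : ∀ ν : ℕ, Integrable (fun V : GaugeConfig 2 L (Matrix.specialUnitaryGroup (Fin 2) ℂ) =>
      Fout V * (U ℝ ν).eval (su2a0 (W V)))
      (Measure.pi fun _ : Edge 2 L => haarProbability (Matrix.specialUnitaryGroup (Fin 2) ℂ)) :=
    fun ν => integrable_pi_su2_of_continuous (hFoutc.mul (continuous_su2Character_comp ν hWc))
  rcases Nat.eq_zero_or_pos μ with hμ0 | hμpos
  · -- `μ = 0`: only `χ_1` appears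
    have hpt : ∀ V : GaugeConfig 2 L (Matrix.specialUnitaryGroup (Fin 2) ℂ),
        su2a0 (W V) * Fout V * (U ℝ μ).eval (su2a0 (W V)) =
        (1 / 2) * (Fout V * (U ℝ (0 + 1 : ℕ)).eval (su2a0 (W V))) := by
      intro V
      have h := mul_chebyshevU_eval (μ : ℤ) (su2a0 (W V))
      rw [hμ0] at h
      push_cast at h
      simp only [U_neg_one, Polynomial.eval_zero, add_zero] at h
      rw [hμ0, mul_comm (su2a0 (W V)) (Fout V), mul_assoc]
      push_cast
      rw [h]
      ring
    simp_rw [hpt]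
    rw [integral_const_mul, hun (0 + 1), hμ0, if_pos rfl]
    push_cast
    ring
  · -- `μ = k + 1`
    obtain ⟨k, hk⟩ : ∃ k, μ = k + 1 := ⟨μ - 1, by omega⟩
    have hpt : ∀ V : GaugeConfig 2 L (Matrix.specialUnitaryGroup (Fin 2) ℂ),
        su2a0 (W V) * Fout V * (U ℝ μ).eval (su2a0 (W V)) =
        (1 / 2) * (Fout V * (U ℝ (k + 1 + 1 : ℕ)).eval (su2a0 (W V))) +
          (1 / 2) * (Fout V * (U ℝ k).eval (su2a0 (W V))) := by
      intro V
      have h := mul_chebyshevU_eval (μ : ℤ) (su2a0 (W V))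
      rw [hk] at h
      push_cast at h
      rw [add_sub_cancel_right] at h
      rw [hk, mul_comm (su2a0 (W V)) (Fout V), mul_assoc]
      push_cast
      rw [h]
      ring
    simp_rw [hpt]
    rw [integral_add ((hint _).const_mul _) ((hint _).const_mul _), integral_const_mul, integral_const_mul,
      hun (k + 1 + 1), hun k, hk, if_neg (Nat.succ_ne_zero k), Nat.add_sub_cancel]
    push_cast
    have hk1 : ((k : ℝ) + 1) ≠ 0 := by positivity
    rw [div_pow, div_pow]
    ring

end Summit.Ventures.LatticeQCDFlow.Scoring
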